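import Literature.NumberTheory.NumberFields.RayClassFieldOfCharacters
import Literature.NumberTheory.QuadraticFields.RingClassGroup
import HarnessLib

/-!
# The ring class field of conductor `f` as a class field: unramified off `f`, and a prime `𝔭 ∤ f`
# splits completely iff its ring class `[𝔭] ∈ I_K(f)/P_{K,ℤ}(f)` is trivial (Cox, §9.A)

Topic `NumberTheory/NumberFields` (class field theory), the ring-class companion of
`RayClassFieldOfCharacters.lean` (`exists_rayClassField_data`: the ray class field `mod 𝔪`) and
`HilbertClassFieldOfCharacters.lean` (`𝔪 = 1`).  Definitions with bodies (the classes
`[𝔞], [𝔭] ∈ I_K(f)/P_{K,ℤ}(f)`) and theorems, all proved from the tree's PROVED global class field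
theory (`exists_classField_of_isRayClassCharacter'`: the class field of a ray class character with
its splitting law in both directions); no named fact (D-0026).

> Cox, *Primes of the form x² + ny²*, §9.A (p. 180): "the **ring class field** of the order
> `𝒪 = ℤ + f𝒪_K` is the unique Abelian extension `L` of `K`" with
> "`Gal(L/K) ≃ C(𝒪) ≃ I_K(f)/P_{K,ℤ}(f)`" (Prop. 7.22), "all primes of `K` ramified in `L` divide
> `f𝒪_K`"; its characteristic property (Thm. 9.2 / Exercise 9.3, via (8.5) "`𝔭` splits completely in
> `L` iff `𝔭 ∈ ker Φ`"): a prime `𝔭 ∤ f` of `K` splits completely in `L` iff `[𝔭] = 1` in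
> `I_K(f)/P_{K,ℤ}(f)`, i.e. iff `𝔭 = α𝒪_K` with `α ≡ a mod f𝒪_K` for an integer `a` prime to `f`.

Here the ring class field is produced, for any number field `K` and `f ≥ 1` with
`I_K(f)/P_{K,ℤ}(f)` finite (the tree's `RingClass.RingClassGroup K f`, `QuadraticFields/RingClassGroup.lean`;
finite e.g. for `K` imaginary quadratic, `RingClass.card_ringClassGroup_mul`), as the compositum
inside `K̄` of the class fields of the characters `𝔭 ↦ χ([𝔭])` of `I_K(f)/P_{K,ℤ}(f)` — these are ray
class characters `mod f𝓞_K` because `P_{K,1}(f) ⊆ P_{K,ℤ}(f)` (Cox (7.21)–Prop. 7.22).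

Main results (`K : Type` a number field, `f ≠ 0`):

* `RingClassField.idealClass f hI hcop`, `RingClassField.primeClass f v` — the classes
  `[𝔞], [𝔭] ∈ I_K(f)/P_{K,ℤ}(f)` of a nonzero integral ideal prime to `f`, resp. of a prime `𝔭 ∤ f`
  (`1` at `𝔭 ∣ f`); `artinSymbol_primeClass_eq_idealClass` (the Artin symbol of `𝔭 ↦ [𝔭]` on an
  integral ideal prime to `f` is its class), `artinKillsRay_primeClass` (`[(b)] = [(c)]` for
  `b ≡ c mod f`, `c` prime to `f`), `isRayClassCharacter_primeClass`;
* `RingClassField.idealClass_span_eq_one` — `[(α)] = 1` for `α ≡ a mod f𝓞_K`, `a ∈ ℤ` prime to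
  `f`; in particular (`primeClass_eq_one_of_span_natCast`) **`[(ℓ)] = 1` for a prime `(ℓ) = ℓ𝓞_K`
  generated by a natural number prime to `f`** (e.g. an inert rational prime);
* `RingClassField.exists_ringClassField_data` — **a finite Galois `R ⊆ K̄` over `K`, unramified at
  every `v ∤ f`, in which a prime `v ∤ f` splits completely iff `[𝔭_v] = 1` in `I_K(f)/P_{K,ℤ}(f)`**;
  `exists_ringClassField_data_principal` — consequently every `v ∤ f` that splits completely in `R`
  is principal, `𝔭_v = (a)`, with `a ≡ n mod f𝓞_K` for an integer `n` prime to `f`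
  (`a ∈ ℤ + f𝓞_K`), and every prime `(ℓ)`, `ℓ ∈ ℕ` prime to `f`, splits completely in `R`.

These are the two inputs — "split ⟹ principal-form norm" and "(ℓ) splits" — under which the tree's
`Literature.NumberTheory.EllipticCurves.rootSet_minpoly_formJ_conductor_subset_of_sub_intCast_mem`
(Deuring–Bauer) places the singular moduli of the order of conductor `f` inside `R`.

## References

* D. A. Cox, *Primes of the form x² + ny²*, 2nd ed., Wiley (2013), §7.C (7.21), Prop. 7.22; §8.A
  (8.5), Thm. 8.2; §9.A (ring class fields, p. 180–181), Thm. 9.2, Exercise 9.3. [Cox2013]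
* J. Neukirch, *Algebraic Number Theory* (1999), Ch. VI §6 (6.2)–(6.3), §7 Thm. (7.1), (7.3).
  [NeukirchANT1999]

## Mathlib / tree search

Tree: `RingClass.RingClassGroup`, `RingClass.mk0_mem_ringClassNum`, `RingClass.prin`,
`RingClass.prin_eq_mk0`, `RingClass.prin_mem_ringClassDen`, `RingClass.exists_eq_mul_inv_of_mem_ringClassDen`
(`QuadraticFields/RingClassGroup.lean`); `exists_classField_of_isRayClassCharacter'`,
`exists_rayClassField_data` (the template followed here), `mem_splitPrimes_of_le`
(`NumberFields/`); `AbelianDensity.artinSymbol`, `artinSymbol_mul`, `artinSymbol_asIdeal`,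
`ArtinKillsRay`, `idealPow_comp_eq` (`LFunctions/AbelianFrobeniusDensity.lean`);
`mem_splitPrimes_intermediateField_iff`, `exists_isArithFrobAt_ringOfIntegers`
(`GaloisRepresentations/FrobeniusDensityTheorem.lean`), `ArtinLemma.isUnramifiedIn_intermediateField`.
Mathlib: `CommGroup.exists_apply_ne_one_of_hasEnoughRootsOfUnity`,
`CommGroup.card_monoidHom_of_hasEnoughRootsOfUnity`, `UniqueFactorizationMonoid.induction_on_prime`.
No ring class FIELD as a class field in Mathlib or the tree (`lean search 'ringClassField'`: only the
concrete `EllipticCurves.ringClassField K ι n ⊂ ℂ` generated by singular moduli, about which no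
class field theory is asserted).
-/

noncomputable section

open NumberField IsDedekindDomain IsDedekindDomain.HeightOneSpectrum Filter Field
open scoped nonZeroDivisors

namespace Literature.NumberTheory.NumberFields

namespace RingClassField

open Literature.NumberTheory.GaloisRepresentations Literature.NumberTheory.Automorphic
  Literature.NumberTheory.LFunctions Literature.NumberTheory.LFunctions.AbelianDensity
  Literature.NumberTheory.QuadraticFields.RingClass

variable {K : Type} [Field K] [NumberField K] (f : ℕ)

/-! ### The classes `[𝔞]`, `[𝔭]` in `I_K(f)/P_{K,ℤ}(f)` -/

section Classes

/-- **The class `[𝔞] ∈ I_K(f)/P_{K,ℤ}(f)`** of a nonzero integral ideal `𝔞` prime to `f`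
(`𝔞 + f𝓞_K = 𝓞_K`). [cite: Cox2013, §7.C (definition of I_K(f)) and Prop. 7.22] -/
def idealClass {I : Ideal (𝓞 K)} (hI : I ≠ ⊥) (hcop : I ⊔ Ideal.span {(f : 𝓞 K)} = ⊤) :
    RingClassGroup K f :=
  QuotientGroup.mk ⟨FractionalIdeal.mk0 K ⟨I, mem_nonZeroDivisors_of_ne_bot hI⟩,
    mk0_mem_ringClassNum hcop hI⟩

/-- Unfolding lemma: `[𝔞]` is the coset of the invertible ideal `𝔞 ∈ I_K(f)`. [cite: Cox2013, §7.C Prop. 7.22] -/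
theorem idealClass_eq {I : Ideal (𝓞 K)} (hI : I ≠ ⊥) (hcop : I ⊔ Ideal.span {(f : 𝓞 K)} = ⊤) :
    idealClass f hI hcop = QuotientGroup.mk ⟨FractionalIdeal.mk0 K ⟨I, mem_nonZeroDivisors_of_ne_bot hI⟩,
      mk0_mem_ringClassNum hcop hI⟩ := rfl

/-- `[𝓞_K] = 1` in `I_K(f)/P_{K,ℤ}(f)`. [cite: Cox2013, §7.C Prop. 7.22] -/
theorem idealClass_top (hcop : (⊤ : Ideal (𝓞 K)) ⊔ Ideal.span {(f : 𝓞 K)} = ⊤) :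
    idealClass f (top_ne_bot : (⊤ : Ideal (𝓞 K)) ≠ ⊥) hcop = 1 := by
  rw [idealClass_eq, ← QuotientGroup.mk_one]
  congr 1
  apply Subtype.ext
  have h1 : (⟨(⊤ : Ideal (𝓞 K)), mem_nonZeroDivisors_of_ne_bot top_ne_bot⟩ : (Ideal (𝓞 K))⁰) = 1 :=
    Subtype.ext Ideal.one_eq_top.symm
  show FractionalIdeal.mk0 K ⟨(⊤ : Ideal (𝓞 K)), mem_nonZeroDivisors_of_ne_bot top_ne_bot⟩ = 1
  rw [h1, map_one]

/-- **Multiplicativity `[𝔞𝔟] = [𝔞][𝔟]`.** [cite: Cox2013, §7.C Prop. 7.20 and Prop. 7.22] -/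
theorem idealClass_mul {I J : Ideal (𝓞 K)} (hI : I ≠ ⊥) (hJ : J ≠ ⊥)
    (hIc : I ⊔ Ideal.span {(f : 𝓞 K)} = ⊤) (hJc : J ⊔ Ideal.span {(f : 𝓞 K)} = ⊤)
    (hIJc : I * J ⊔ Ideal.span {(f : 𝓞 K)} = ⊤) :
    idealClass f (mul_ne_zero hI hJ : I * J ≠ ⊥) hIJc = idealClass f hI hIc * idealClass f hJ hJc := by
  rw [idealClass_eq, idealClass_eq, idealClass_eq, ← QuotientGroup.mk_mul]
  congr 1
  apply Subtype.ext
  have h1 : (⟨I * J, mem_nonZeroDivisors_of_ne_bot (mul_ne_zero hI hJ)⟩ : (Ideal (𝓞 K))⁰) =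
      ⟨I, mem_nonZeroDivisors_of_ne_bot hI⟩ * ⟨J, mem_nonZeroDivisors_of_ne_bot hJ⟩ :=
    Subtype.ext rfl
  show FractionalIdeal.mk0 K ⟨I * J, mem_nonZeroDivisors_of_ne_bot (mul_ne_zero hI hJ)⟩ =
    FractionalIdeal.mk0 K ⟨I, mem_nonZeroDivisors_of_ne_bot hI⟩ *
      FractionalIdeal.mk0 K ⟨J, mem_nonZeroDivisors_of_ne_bot hJ⟩
  rw [h1, map_mul]

open scoped Classical in
/-- **The class `[𝔭] ∈ I_K(f)/P_{K,ℤ}(f)` of a prime `𝔭 ∤ f`** (and `1` for `𝔭 ∣ f`).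
[cite: Cox2013, §7.C Prop. 7.22 and §9.A] -/
def primeClass (v : HeightOneSpectrum (𝓞 K)) : RingClassGroup K f :=
  if h : v.asIdeal ⊔ Ideal.span {(f : 𝓞 K)} = ⊤ then idealClass f v.ne_bot h else 1

/-- Unfolding lemma at a prime `𝔭 ∤ f`: `[𝔭]` is the class of `𝔭 ∈ I_K(f)` (the primes not dividing
`f` lie in, indeed generate, `I_K(f)`). [cite: Cox2013, §7.C Prop. 7.20 and Prop. 7.22] -/
theorem primeClass_of_sup_eq_top {v : HeightOneSpectrum (𝓞 K)} (h : v.asIdeal ⊔ Ideal.span {(f : 𝓞 K)} = ⊤) :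
    primeClass f v = idealClass f v.ne_bot h := by
  classical
  rw [primeClass, dif_pos h]

/-- Unfolding lemma at a prime `𝔭 ∣ f` (junk value `1`; such primes are not in `I_K(f)`).
[cite: Cox2013, §7.C Prop. 7.20] -/
theorem primeClass_of_sup_ne_top {v : HeightOneSpectrum (𝓞 K)} (h : v.asIdeal ⊔ Ideal.span {(f : 𝓞 K)} ≠ ⊤) :
    primeClass f v = 1 := by
  classical
  rw [primeClass, dif_neg h]

/-- `𝔭 ∤ f ⟺ 𝔭 + f𝓞_K = 𝓞_K` for a maximal ideal `𝔭` ("prime to `f`"). [cite: Cox2013, §7.C (ideals prime to f, before Prop. 7.20)] -/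
theorem sup_span_eq_top_iff_not_le {v : HeightOneSpectrum (𝓞 K)} :
    v.asIdeal ⊔ Ideal.span {(f : 𝓞 K)} = ⊤ ↔ ¬ Ideal.span {(f : 𝓞 K)} ≤ v.asIdeal := by
  constructor
  · intro h hle
    have : v.asIdeal ⊔ Ideal.span {(f : 𝓞 K)} ≤ v.asIdeal := sup_le le_rfl hle
    rw [h, top_le_iff] at this
    exact v.isPrime.ne_top this
  · intro h
    exact v.isMaximal.out.2 _ (lt_of_le_of_ne le_sup_left fun heq => h (le_sup_right.trans heq.symm.le))

/-- The class of a principal ideal `(α)` prime to `f` is the class of the unit `prin α = α𝓞_K ∈ I_K(f)`.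
[cite: Cox2013, §7.A (principal fractional ideals P(𝒪)) and §7.C Prop. 7.22] -/
theorem idealClass_span_eq {α : 𝓞 K} (hα : α ≠ 0)
    (hcop : Ideal.span {α} ⊔ Ideal.span {(f : 𝓞 K)} = ⊤) :
    idealClass f (by simpa [Ideal.span_singleton_eq_bot] using hα : Ideal.span {α} ≠ ⊥) hcop =
      QuotientGroup.mk ⟨prin K α hα, prin_mem_ringClassNum hα hcop⟩ := by
  rw [idealClass_eq]
  congr 1
  apply Subtype.ext
  exact (prin_eq_mk0 α hα).symm

/-- `[(α)] = 1` for `α ≡ a (mod f𝓞_K)`, `a ∈ ℤ` prime to `f`: the generators of `P_{K,ℤ}(f)` have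
trivial class. [cite: Cox2013, §7.C (definition of P_{K,ℤ}(f)) and Prop. 7.22] -/
theorem idealClass_span_eq_one {α : 𝓞 K} (hα : α ≠ 0) {a : ℤ} (ha : IsCoprime a (f : ℤ))
    (h : α - (a : 𝓞 K) ∈ Ideal.span {(f : 𝓞 K)})
    (hcop : Ideal.span {α} ⊔ Ideal.span {(f : 𝓞 K)} = ⊤) :
    idealClass f (by simpa [Ideal.span_singleton_eq_bot] using hα : Ideal.span {α} ≠ ⊥) hcop = 1 := by
  rw [idealClass_span_eq f hα hcop, QuotientGroup.eq_one_iff, Subgroup.mem_subgroupOf]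
  change prin K α hα ∈ ringClassDen K f
  exact prin_mem_ringClassDen hα ha h

omit [NumberField K] in
/-- An ideal `(ℓ) = ℓ𝓞_K` generated by a natural number `ℓ` prime to `f` (e.g. an inert rational prime)
is prime to `f`: `ℓ𝓞_K + f𝓞_K = 𝓞_K`. [cite: Cox2013, §9.A Thm. 9.2 (p prime to the conductor f)] -/
theorem span_natCast_sup_eq_top {ℓ : ℕ} (hℓ : Nat.Coprime ℓ f) :
    Ideal.span {(ℓ : 𝓞 K)} ⊔ Ideal.span {(f : 𝓞 K)} = ⊤ := by
  rw [← Ideal.isCoprime_iff_sup_eq, Ideal.isCoprime_span_singleton_iff]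
  have h : IsCoprime (ℓ : ℤ) (f : ℤ) := Nat.isCoprime_iff_coprime.mpr hℓ
  obtain ⟨u, v, huv⟩ := h
  refine ⟨(u : 𝓞 K), (v : 𝓞 K), ?_⟩
  have := congrArg (fun z : ℤ => (z : 𝓞 K)) huv
  push_cast at this
  exact this

/-- **`[(ℓ)] = 1` for a prime `𝔭 = ℓ𝓞_K` generated by a natural number `ℓ` prime to `f`** — in
particular for a rational prime `ℓ ∤ f` inert in a quadratic `K`: `ℓ ≡ ℓ (mod f𝓞_K)` with `ℓ ∈ ℤ`
prime to `f`, so `(ℓ) ∈ P_{K,ℤ}(f)` (Cox §9.A: such primes split completely in the ring class field).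
[cite: Cox2013, §7.C Prop. 7.22 and §9.A Thm. 9.2] -/
theorem primeClass_eq_one_of_span_natCast {v : HeightOneSpectrum (𝓞 K)} {ℓ : ℕ}
    (hv : v.asIdeal = Ideal.span {(ℓ : 𝓞 K)}) (hℓ : Nat.Coprime ℓ f) : primeClass f v = 1 := by
  have hcop : v.asIdeal ⊔ Ideal.span {(f : 𝓞 K)} = ⊤ := by
    rw [hv]; exact span_natCast_sup_eq_top f hℓ
  rw [primeClass_of_sup_eq_top f hcop]
  have hℓ0 : (ℓ : 𝓞 K) ≠ 0 := by
    intro h0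
    apply v.ne_bot
    rw [hv, Ideal.span_singleton_eq_bot]
    exact h0
  have hcop' : Ideal.span {(ℓ : 𝓞 K)} ⊔ Ideal.span {(f : 𝓞 K)} = ⊤ := span_natCast_sup_eq_top f hℓ
  have key := idealClass_span_eq_one f hℓ0 (a := (ℓ : ℤ)) (Nat.isCoprime_iff_coprime.mpr hℓ)
    (by simp) hcop'
  convert key using 2

end Classes

/-! ### The Artin symbol of `𝔭 ↦ [𝔭]` is the class map on integral ideals prime to `f` -/

section Artin

/-- **`∏_𝔭 [𝔭]^{ν_𝔭(𝔞)} = [𝔞]`** for a nonzero integral ideal `𝔞` prime to `f` (induction on the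
factorisation of `𝔞`; Cox Prop. 7.20: `I_K(f)` is generated by the primes not dividing `f`).
[cite: Cox2013, §7.C Prop. 7.20 and Prop. 7.22] -/
theorem artinSymbol_primeClass_eq_idealClass {I : Ideal (𝓞 K)} (hI : I ≠ ⊥)
    (hcop : I ⊔ Ideal.span {(f : 𝓞 K)} = ⊤) :
    artinSymbol (primeClass f) I = idealClass f hI hcop := by
  revert hI hcop
  refine UniqueFactorizationMonoid.induction_on_prime I (fun h => absurd rfl h) ?_ ?_
  · intro J hJ _ hcop
    rw [Ideal.isUnit_iff] at hJ
    subst hJ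
    have h1 : artinSymbol (primeClass f) (⊤ : Ideal (𝓞 K)) = 1 := by
      have h := artinSymbol_finsuppProd (primeClass (K := K) f) 0
      rwa [Finsupp.prod_zero_index, Finsupp.prod_zero_index, Ideal.one_eq_top] at h
    rw [h1, idealClass_top]
  · intro J q hJ hq ih hqJ hcop
    have hq0 : q ≠ ⊥ := hq.ne_zero
    haveI hqp : q.IsPrime := Ideal.isPrime_of_prime hq
    set v : HeightOneSpectrum (𝓞 K) := ⟨q, hqp, hq0⟩
    have hqc : q ⊔ Ideal.span {(f : 𝓞 K)} = ⊤ :=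
      top_le_iff.mp (hcop ▸ sup_le_sup_right Ideal.mul_le_right _)
    have hJc : J ⊔ Ideal.span {(f : 𝓞 K)} = ⊤ :=
      top_le_iff.mp (hcop ▸ sup_le_sup_right Ideal.mul_le_left _)
    have hq' : artinSymbol (primeClass f) q = primeClass f v := artinSymbol_asIdeal (primeClass f) v
    rw [artinSymbol_mul (primeClass f) hq0 hJ, ih hJ hJc, hq', primeClass_of_sup_eq_top f (v := v) hqc]
    exact (idealClass_mul f hq0 hJ hqc hJc hcop).symm

/-- **The Artin symbol of `𝔭 ↦ [𝔭]` kills the ray `P_{K,1}(f)`**: `[(b)] = [(c)]` for nonzero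
`b ≡ c (mod f𝓞_K)` with `c` prime to `f` (choose `c'` with `cc' ≡ 1`; then `(b)(c)⁻¹ = (bc')(cc')⁻¹`
with `bc' ≡ cc' ≡ 1 (mod f𝓞_K)`, both in `P_{K,ℤ}(f)` — Cox (7.21): `P_{K,1}(f) ⊆ P_{K,ℤ}(f)`).
[cite: Cox2013, §7.C (7.21) and Prop. 7.22] -/
theorem artinKillsRay_primeClass : ArtinKillsRay (Ideal.span {(f : 𝓞 K)}) (primeClass (K := K) f) := by
  intro b c hb hc hcop hbc _
  have hcc : Ideal.span {c} ⊔ Ideal.span {(f : 𝓞 K)} = ⊤ := Ideal.isCoprime_iff_sup_eq.mp hcop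
  have hcmem : c ∈ Ideal.span {b} ⊔ Ideal.span {(f : 𝓞 K)} := by
    have : c = b - (b - c) := by ring
    rw [this]
    exact Submodule.sub_mem _ (Ideal.mem_sup_left (Ideal.mem_span_singleton_self b))
      (Ideal.mem_sup_right hbc)
  have hbb : Ideal.span {b} ⊔ Ideal.span {(f : 𝓞 K)} = ⊤ := by
    rw [eq_top_iff, ← hcc]
    exact sup_le ((Ideal.span_singleton_le_iff_mem _).mpr hcmem) le_sup_right
  have hb' : Ideal.span {b} ≠ ⊥ := by simpa [Ideal.span_singleton_eq_bot] using hb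
  have hc' : Ideal.span {c} ≠ ⊥ := by simpa [Ideal.span_singleton_eq_bot] using hc
  rw [artinSymbol_primeClass_eq_idealClass f hb' hbb, artinSymbol_primeClass_eq_idealClass f hc' hcc,
    idealClass_span_eq f hb hbb, idealClass_span_eq f hc hcc, QuotientGroup.eq, Subgroup.mem_subgroupOf]
  change (prin K b hb)⁻¹ * prin K c hc ∈ ringClassDen K f
  -- `c c' ≡ 1 (mod f)`
  obtain ⟨x, hx, y, hy, hxy⟩ := Ideal.isCoprime_iff_exists.mp hcop
  obtain ⟨c', hc'x⟩ := Ideal.mem_span_singleton'.mp hx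
  have hcc' : c * c' - 1 ∈ Ideal.span {(f : 𝓞 K)} := by
    have : c * c' - 1 = -y := by rw [mul_comm, hc'x]; linear_combination hxy
    rw [this]
    exact Submodule.neg_mem _ hy
  by_cases hc'0 : c' = 0
  · -- then `1 ∈ (f)`, `P_{K,ℤ}(f)` contains every principal ideal
    rw [hc'0, mul_zero, zero_sub] at hcc'
    have h1 : (1 : 𝓞 K) ∈ Ideal.span {(f : 𝓞 K)} := by simpa using Submodule.neg_mem _ hcc'
    have hall : ∀ z : 𝓞 K, z - ((1 : ℤ) : 𝓞 K) ∈ Ideal.span {(f : 𝓞 K)} := fun z => by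
      simpa using Ideal.mul_mem_left _ (z - 1) h1
    exact Subgroup.mul_mem _ (Subgroup.inv_mem _ (prin_mem_ringClassDen _ isCoprime_one_left (hall b)))
      (prin_mem_ringClassDen _ isCoprime_one_left (hall c))
  have hbc' : b * c' - 1 ∈ Ideal.span {(f : 𝓞 K)} := by
    have : b * c' - 1 = (b - c) * c' + (c * c' - 1) := by ring
    rw [this]
    exact Submodule.add_mem _ (Ideal.mul_mem_right _ _ hbc) hcc'
  have hden_b : prin K (b * c') (mul_ne_zero hb hc'0) ∈ ringClassDen K f :=
    prin_mem_ringClassDen _ (a := 1) isCoprime_one_left (by simpa using hbc')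
  have hden_c : prin K (c * c') (mul_ne_zero hc hc'0) ∈ ringClassDen K f :=
    prin_mem_ringClassDen _ (a := 1) isCoprime_one_left (by simpa using hcc')
  have key : (prin K b hb)⁻¹ * prin K c hc =
      (prin K (b * c') (mul_ne_zero hb hc'0))⁻¹ * prin K (c * c') (mul_ne_zero hc hc'0) := by
    rw [prin_mul b c' hb hc'0, prin_mul c c' hc hc'0, mul_inv, mul_assoc, mul_comm (prin K c' hc'0)⁻¹,
      mul_assoc, mul_inv_cancel, mul_one]
  rw [key]
  exact Subgroup.mul_mem _ (Subgroup.inv_mem _ hden_b) hden_c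

/-- **`𝔭 ↦ χ([𝔭])` is a ray class character `mod f𝓞_K`** for every homomorphism
`χ : I_K(f)/P_{K,ℤ}(f) → ℂˣ` (granted the finiteness of the ring class group, for the norm-one
condition). [cite: Cox2013, §7.C (7.21)–Prop. 7.22] [cite: NeukirchANT1999, Ch. VII §6 Def. (6.8)] -/
theorem isRayClassCharacter_primeClass [Finite (RingClassGroup K f)] (χ : RingClassGroup K f →* ℂˣ) :
    IsRayClassCharacter (Ideal.span {(f : 𝓞 K)}) (fun v => (χ (primeClass f v) : ℂ)) := by
  classical
  refine ⟨fun v _ => ?_, fun b c hb hc hcop hbc hpos => ?_⟩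
  · haveI : Fintype (RingClassGroup K f) := Fintype.ofFinite _
    have hpow : (χ (primeClass f v) : ℂ) ^ Fintype.card (RingClassGroup K f) = 1 := by
      rw [← Units.val_pow_eq_pow_val, ← map_pow, pow_card_eq_one, map_one, Units.val_one]
    exact Complex.norm_eq_one_of_pow_eq_one hpow Fintype.card_ne_zero
  · have hb' : Ideal.span {b} ≠ ⊥ := by simpa [Ideal.span_singleton_eq_bot] using hb
    have hc' : Ideal.span {c} ≠ ⊥ := by simpa [Ideal.span_singleton_eq_bot] using hc
    have key := artinKillsRay_primeClass (K := K) f b c hb hc hcop hbc hpos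
    have e : (fun v => (χ (primeClass f v) : ℂ)) =
        fun v => ((Units.coeHom ℂ).comp χ) (primeClass f v) := rfl
    rw [e, idealPow_comp_eq ((Units.coeHom ℂ).comp χ) (primeClass f) hb',
      idealPow_comp_eq ((Units.coeHom ℂ).comp χ) (primeClass f) hc', key]

end Artin

/-! ### The ring class field of conductor `f` -/

section ClassField

/-- **The ring class field of conductor `f` (Cox §9.A) from the tree's class field theory.**  Let
`K` be a number field and `f ≥ 1` with finite ring class group `I_K(f)/P_{K,ℤ}(f)`.  There is a
finite Galois `R ⊆ K̄` over `K` such that (i) `R` is unramified at every prime `v ∤ f`, and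
(ii) a prime `v ∤ f` splits completely in `R` **iff** `[𝔭_v] = 1` in `I_K(f)/P_{K,ℤ}(f)`.
Construction: `R` is the compositum of the class fields `E_χ` (`exists_classField_of_isRayClassCharacter'`)
of the ray class characters `𝔭 ↦ χ([𝔭])`, `χ` ranging over the finitely many characters of
`I_K(f)/P_{K,ℤ}(f)`; an inertia element at `v ∤ f` fixes every `E_χ`, hence `R`; a prime splitting
completely in `R` splits in every `E_χ`, so `χ([𝔭]) = 1` for all `χ`, i.e. `[𝔭] = 1`; conversely if
`[𝔭] = 1` then `𝔭` splits in every `E_χ`, so a Frobenius of `R` at `𝔭` fixes every `E_χ`, hence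
`R`, and `𝔭` splits completely in `R`.  (Cox §9.A with (8.5): "`𝔭` splits completely in `L` iff
`((L/K)/𝔭) = 1`", `Gal(L/K) ≃ I_K(f)/P_{K,ℤ}(f)`; here only the splitting law is recorded, not the
Artin isomorphism.) [cite: Cox2013, §9.A (pp. 180–181) with §8.A (8.5) and Thm. 9.2]
[cite: NeukirchANT1999, Ch. VI §6 (6.2)–(6.3) and §7 Thm. (7.1), (7.3)] -/
theorem exists_ringClassField_data [Finite (RingClassGroup K f)] (hf : f ≠ 0) :
    ∃ R : IntermediateField K (AlgebraicClosure K), FiniteDimensional K R ∧ IsGalois K R ∧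
      (∀ v : HeightOneSpectrum (𝓞 K), ¬ Ideal.span {(f : 𝓞 K)} ≤ v.asIdeal →
        Algebra.IsUnramifiedIn (𝓞 R) v.asIdeal) ∧
      ∀ v : HeightOneSpectrum (𝓞 K), ¬ Ideal.span {(f : 𝓞 K)} ≤ v.asIdeal →
        (v ∈ splitPrimes K R ↔ primeClass f v = 1) := by
  classical
  have h𝔪 : Ideal.span {(f : 𝓞 K)} ≠ ⊥ := by
    rw [Ne, Ideal.span_singleton_eq_bot]
    exact_mod_cast hf
  -- finitely many characters; enough roots of unity in `ℂ`
  haveI : NeZero ((Monoid.exponent (RingClassGroup K f) : ℕ) : ℂ) :=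
    ⟨Nat.cast_ne_zero.mpr (Monoid.exponent_ne_zero.mpr
      (Monoid.ExponentExists.of_finite (G := RingClassGroup K f)))⟩
  haveI : HasEnoughRootsOfUnity ℂ (Monoid.exponent (RingClassGroup K f)) := inferInstance
  have hcard : Nat.card (RingClassGroup K f →* ℂˣ) = Nat.card (RingClassGroup K f) :=
    CommGroup.card_monoidHom_of_hasEnoughRootsOfUnity (RingClassGroup K f) ℂ
  haveI : Finite (RingClassGroup K f →* ℂˣ) :=
    Nat.finite_of_card_ne_zero (by rw [hcard]; exact Nat.card_pos.ne')
  -- the class fields of the characters `𝔭 ↦ χ([𝔭])`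
  choose E hE using fun χ : RingClassGroup K f →* ℂˣ =>
    exists_classField_of_isRayClassCharacter' h𝔪 (isRayClassCharacter_primeClass f χ)
  haveI : ∀ χ, FiniteDimensional K (E χ) := fun χ => (hE χ).1
  haveI : ∀ χ, IsGalois K (E χ) := fun χ => (hE χ).2.1
  haveI : ∀ χ, NumberField (E χ) := fun χ => NumberField.of_module_finite K (E χ)
  set R : IntermediateField K (AlgebraicClosure K) := ⨆ χ, E χ with hRdef
  haveI : FiniteDimensional K R := by rw [hRdef]; infer_instance
  haveI : Normal K R := by rw [hRdef]; infer_instance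
  haveI : IsGalois K R := IsGalois.mk
  haveI : NumberField R := NumberField.of_module_finite K R
  -- (i) `R/K` is unramified off `f`
  have hunrR : ∀ v : HeightOneSpectrum (𝓞 K), ¬ Ideal.span {(f : 𝓞 K)} ≤ v.asIdeal →
      Algebra.IsUnramifiedIn (𝓞 R) v.asIdeal := by
    intro v hv
    by_contra hram
    obtain ⟨𝔓, h𝔓, g, hg, hne⟩ := exists_mem_inertia_absRestrictNormalHom_ne_one (L := R) hram
    apply hne
    rw [absRestrictNormalHom_eq_one_iff]
    have hfix : ∀ χ, absoluteGaloisGroup.toAlgEquiv K g ∈ (E χ).fixingSubgroup := fun χ => by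
      haveI : NumberField (E χ) := NumberField.of_module_finite K _
      rw [← absRestrictNormalHom_eq_one_iff]
      exact absRestrictNormalHom_eq_one_of_isUnramifiedIn (E χ) ((hE χ).2.2.1 v hv) h𝔓 hg
    have hle : R ≤ IntermediateField.fixedField
        (Subgroup.zpowers (absoluteGaloisGroup.toAlgEquiv K g)) := by
      rw [hRdef]
      refine iSup_le fun χ => ?_
      rw [IntermediateField.le_iff_le, Subgroup.zpowers_le]
      exact hfix χ
    rw [IntermediateField.le_iff_le, Subgroup.zpowers_le] at hle
    exact hle
  refine ⟨R, inferInstance, inferInstance, hunrR, fun v hv => ⟨fun hsplit => ?_, fun h1 => ?_⟩⟩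
  · -- (ii') split ⟹ `χ([v]) = 1` for every character ⟹ `[v] = 1`
    have h1 : ∀ χ : RingClassGroup K f →* ℂˣ, χ (primeClass f v) = 1 := fun χ => by
      have hvE : v ∈ splitPrimes K (E χ) :=
        mem_splitPrimes_of_le (by rw [hRdef]; exact le_iSup E χ) ((hE χ).2.2.1 v hv) hsplit
      have := (hE χ).2.2.2.2.1 v hv hvE
      exact Units.val_injective (by rw [Units.val_one]; exact this)
    by_contra hne
    obtain ⟨φ, hφ⟩ := CommGroup.exists_apply_ne_one_of_hasEnoughRootsOfUnity (RingClassGroup K f) ℂ hne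
    exact hφ (h1 φ)
  · -- (ii) `[v] = 1` ⟹ `v` splits in every `E_χ` ⟹ a Frobenius of `R` at `v` fixes `R`
    have hvE : ∀ χ, v ∈ splitPrimes K (E χ) := fun χ =>
      (hE χ).2.2.2.1 v hv (by simp only [h1, map_one, Units.val_one])
    -- a prime of `𝓞 R` above `v` and a Frobenius there
    haveI := v.isMaximal
    obtain ⟨Q, hQmax, hQover⟩ := Ideal.exists_maximal_ideal_liesOver_of_isIntegral (S := 𝓞 R) v.asIdeal
    haveI := hQmax
    haveI := hQover
    have hQ : Q ∈ v.asIdeal.primesOver (𝓞 R) := ⟨hQmax.isPrime, hQover⟩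
    have hQbot : Q ≠ ⊥ := Ideal.ne_bot_of_liesOver_of_ne_bot v.ne_bot Q
    obtain ⟨φ, hφ⟩ := exists_isArithFrobAt_ringOfIntegers (M := K) Q hQbot
    -- `φ` fixes every `E_χ` (viewed inside `R`)
    have hfixE : ∀ χ, ∀ x : R, (x : AlgebraicClosure K) ∈ E χ → φ x = x := by
      intro χ x hx
      have hle : E χ ≤ R := by rw [hRdef]; exact le_iSup E χ
      set E' : IntermediateField K R := IntermediateField.restrict hle with hE'
      haveI : IsGalois K E' := IsGalois.of_algEquiv (IntermediateField.restrict_algEquiv hle)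
      have hunrE' : Algebra.IsUnramifiedIn (𝓞 E') v.asIdeal :=
        ArtinLemma.isUnramifiedIn_intermediateField E' (hunrR v hv)
      have hvE' : v ∈ splitPrimes K E' := by
        rw [hE', ← Literature.NumberTheory.EllipticCurves.splitPrimes_eq_of_algEquiv
          (IntermediateField.restrict_algEquiv hle)]
        exact hvE χ
      have hmem := (mem_splitPrimes_intermediateField_iff E' (hunrR v hv) hunrE' hQ hφ).mp hvE'
      rw [IntermediateField.mem_fixingSubgroup_iff] at hmem
      exact hmem x ((IntermediateField.mem_restrict hle x).mpr hx)
    -- hence `φ` fixes `R = ⨆ E_χ`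
    have hfix : ∀ x : R, φ x = x := by
      set Fφ : IntermediateField K R := IntermediateField.fixedField (Subgroup.zpowers φ) with hFφ
      have hmemF : ∀ y : R, φ y = y → y ∈ Fφ := fun y hy => by
        rw [hFφ, IntermediateField.mem_fixedField_iff]
        intro g' hg'
        obtain ⟨k, rfl⟩ := Subgroup.mem_zpowers_iff.mp hg'
        have hpos : ∀ n : ℕ, (φ ^ n) y = y := by
          intro n
          induction n with
          | zero => simp
          | succ n ih => rw [pow_succ, AlgEquiv.mul_apply, hy, ih]
        rcases Int.eq_nat_or_neg k with ⟨n, rfl | rfl⟩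
        · rw [zpow_natCast]; exact hpos n
        · rw [_root_.zpow_neg, zpow_natCast]
          have := hpos n
          conv_lhs => rw [← this]
          rw [← AlgEquiv.mul_apply, inv_mul_cancel, AlgEquiv.one_apply]
      have hRle : R ≤ IntermediateField.lift Fφ := by
        conv_lhs => rw [hRdef]
        refine iSup_le fun χ => ?_
        intro t ht
        have htR : t ∈ R := by rw [hRdef]; exact (le_iSup E χ) ht
        exact (IntermediateField.mem_lift ⟨t, htR⟩).mpr (hmemF _ (hfixE χ ⟨t, htR⟩ ht))
      intro x
      have hxF : x ∈ Fφ := (IntermediateField.mem_lift x).mp (hRle x.2)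
      rw [hFφ, IntermediateField.mem_fixedField_iff] at hxF
      exact hxF φ (Subgroup.mem_zpowers φ)
    -- so `v` splits completely in `⊤ = R`
    haveI : IsGalois K (⊤ : IntermediateField K R) := IsGalois.of_algEquiv IntermediateField.topEquiv.symm
    have hunrT : Algebra.IsUnramifiedIn (𝓞 (⊤ : IntermediateField K R)) v.asIdeal :=
      ArtinLemma.isUnramifiedIn_intermediateField ⊤ (hunrR v hv)
    have hT : v ∈ splitPrimes K (⊤ : IntermediateField K R) := by
      refine (mem_splitPrimes_intermediateField_iff ⊤ (hunrR v hv) hunrT hQ hφ).mpr ?_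
      rw [IntermediateField.mem_fixingSubgroup_iff]
      intro x _
      exact hfix x
    rwa [Literature.NumberTheory.EllipticCurves.splitPrimes_eq_of_algEquiv
      (IntermediateField.topEquiv (F := K) (E := R))] at hT

/-- **Consequences of the splitting law.**  With `R` as in `exists_ringClassField_data`: every prime
`v ∤ f` that splits completely in `R` is principal, `𝔭_v = (a)`, with a generator `a ≡ n (mod f𝓞_K)`
for an integer `n` prime to `f` (i.e. `a ∈ ℤ + f𝓞_K` invertible mod `f`: `[𝔭_v] = 1` means
`𝔭_v = (α)(β)⁻¹` with `α ≡ a, β ≡ b` integers prime to `f`; then `a' := α/β ∈ 𝔭_v ⊆ 𝓞_K` generates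
`𝔭_v` and `a' b ≡ a (mod f)`), and every prime `(ℓ) = ℓ𝓞_K` with `ℓ ∈ ℕ` prime to `f` splits
completely in `R` (Cox Thm. 9.2 / §9.A: the primes splitting completely in the ring class field of
`𝒪 = ℤ + f𝒪_K` are those `= α𝒪_K`, `α ∈ 𝒪` prime to `f`).
[cite: Cox2013, §9.A Thm. 9.2 and Exercise 9.3] [cite: NeukirchANT1999, Ch. VI §7 (7.3)] -/
theorem exists_ringClassField_data_principal [Finite (RingClassGroup K f)] (hf : f ≠ 0) :
    ∃ R : IntermediateField K (AlgebraicClosure K), FiniteDimensional K R ∧ IsGalois K R ∧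
      (∀ v : HeightOneSpectrum (𝓞 K), ¬ Ideal.span {(f : 𝓞 K)} ≤ v.asIdeal →
        Algebra.IsUnramifiedIn (𝓞 R) v.asIdeal) ∧
      (∀ v : HeightOneSpectrum (𝓞 K), ¬ Ideal.span {(f : 𝓞 K)} ≤ v.asIdeal → v ∈ splitPrimes K R →
        ∃ (a : 𝓞 K) (n : ℤ), IsCoprime n (f : ℤ) ∧ v.asIdeal = Ideal.span {a} ∧
          a - (n : 𝓞 K) ∈ Ideal.span {(f : 𝓞 K)}) ∧
      (∀ (v : HeightOneSpectrum (𝓞 K)) (ℓ : ℕ), v.asIdeal = Ideal.span {(ℓ : 𝓞 K)} →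
        Nat.Coprime ℓ f → v ∈ splitPrimes K R) := by
  classical
  obtain ⟨R, hfd, hgal, hunr, hspl⟩ := exists_ringClassField_data (K := K) f hf
  refine ⟨R, hfd, hgal, hunr, fun v hv hsplit => ?_, fun v ℓ hvℓ hℓ => ?_⟩
  · have h1 := (hspl v hv).mp hsplit
    have hcop : v.asIdeal ⊔ Ideal.span {(f : 𝓞 K)} = ⊤ := (sup_span_eq_top_iff_not_le f).mpr hv
    rw [primeClass_of_sup_eq_top f hcop, idealClass_eq, QuotientGroup.eq_one_iff,
      Subgroup.mem_subgroupOf] at h1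
    -- `𝔭_v = g h⁻¹` with `g, h` generators of `P_{K,ℤ}(f)`
    obtain ⟨g, hg, h, hh, hgh⟩ := exists_eq_mul_inv_of_mem_ringClassDen h1
    obtain ⟨α, a, ha, hαa, hgα⟩ := hg
    obtain ⟨β, b, hb, hβb, hhβ⟩ := hh
    have hβ0 : β ≠ 0 := by
      rintro rfl
      have : ((h : (FractionalIdeal (𝓞 K)⁰ K)ˣ) : FractionalIdeal (𝓞 K)⁰ K) = 0 := by
        rw [hhβ]; simp
      exact Units.ne_zero h this
    have hα0 : α ≠ 0 := by
      rintro rfl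
      have : ((g : (FractionalIdeal (𝓞 K)⁰ K)ˣ) : FractionalIdeal (𝓞 K)⁰ K) = 0 := by
        rw [hgα]; simp
      exact Units.ne_zero g this
    -- the fractional ideal `𝔭_v · (β) = (α)`
    have hvfrac : ((v.asIdeal : FractionalIdeal (𝓞 K)⁰ K)) * FractionalIdeal.spanSingleton (𝓞 K)⁰ (β : K) =
        FractionalIdeal.spanSingleton (𝓞 K)⁰ (α : K) := by
      have hval := congrArg (fun u : (FractionalIdeal (𝓞 K)⁰ K)ˣ => (u : FractionalIdeal (𝓞 K)⁰ K)) hgh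
      simp only [Units.val_mul, Units.val_inv_eq_inv_val, FractionalIdeal.coe_mk0] at hval
      rw [hgα, hhβ] at hval
      have hβK : (β : K) ≠ 0 := RingOfIntegers.coe_ne_zero_iff.mpr hβ0
      rw [eq_mul_inv_iff_mul_eq₀ (by
        rw [Ne, FractionalIdeal.spanSingleton_eq_zero_iff]; exact hβK)] at hval
      exact hval
    -- `a' := α / β` lies in `𝓞 K` and generates `𝔭_v`
    have hβK : (β : K) ≠ 0 := RingOfIntegers.coe_ne_zero_iff.mpr hβ0
    have hspan : (v.asIdeal : FractionalIdeal (𝓞 K)⁰ K) =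
        FractionalIdeal.spanSingleton (𝓞 K)⁰ ((α : K) / (β : K)) := by
      rw [div_eq_mul_inv, ← FractionalIdeal.spanSingleton_mul_spanSingleton, ← hvfrac, mul_assoc,
        FractionalIdeal.spanSingleton_mul_spanSingleton, mul_inv_cancel₀ hβK,
        FractionalIdeal.spanSingleton_one, mul_one]
    have hmem : (α : K) / (β : K) ∈ (v.asIdeal : FractionalIdeal (𝓞 K)⁰ K) := by
      rw [hspan]; exact FractionalIdeal.mem_spanSingleton_self _ _
    rw [FractionalIdeal.mem_coeIdeal] at hmem
    obtain ⟨a', ha'v, ha'⟩ := hmem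
    refine ⟨a', ?_⟩
    have hva' : v.asIdeal = Ideal.span {a'} := by
      apply FractionalIdeal.coeIdeal_injective (K := K)
      show (v.asIdeal : FractionalIdeal (𝓞 K)⁰ K) = ((Ideal.span {a'} : Ideal (𝓞 K)) : FractionalIdeal (𝓞 K)⁰ K)
      rw [hspan, FractionalIdeal.coeIdeal_span_singleton, ha']
    -- congruence: `a' β = α`, `β ≡ b`, `α ≡ a`; choose `b'` with `b b' ≡ 1 (mod f)`
    have hab : a' * β = α := by
      apply RingOfIntegers.coe_injective
      rw [map_mul, ha', div_mul_cancel₀ _ hβK]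
    obtain ⟨b', k, hbk⟩ := hb
    -- `b' b + k f = 1`
    refine ⟨a * b', ?_, hva', ?_⟩
    · -- `a b'` is prime to `f`
      have hb'cop : IsCoprime b' (f : ℤ) := ⟨b, k, by linear_combination hbk⟩
      exact IsCoprime.mul_left ha hb'cop
    · -- `a' - a b' = a' (1 - b b') + b' (a' β - α) + b' (α - a) - a' b' (β - b)`… computed mod `f`
      have h1 : a' - ((a * b' : ℤ) : 𝓞 K) =
          a' * ((k * (f : ℤ) : ℤ) : 𝓞 K) + (b' : 𝓞 K) * (α - (a : 𝓞 K)) -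
            a' * (b' : 𝓞 K) * (β - (b : 𝓞 K)) := by
        have hk : ((k * (f : ℤ) : ℤ) : 𝓞 K) = 1 - (b' : 𝓞 K) * (b : 𝓞 K) := by
          have := congrArg (fun z : ℤ => (z : 𝓞 K)) hbk
          push_cast at this ⊢
          linear_combination this
        rw [hk, ← hab]
        push_cast
        ring
      rw [h1]
      refine Submodule.sub_mem _ (Submodule.add_mem _ ?_ (Ideal.mul_mem_left _ _ hαa))
        (Ideal.mul_mem_left _ _ hβb)
      have : ((k * (f : ℤ) : ℤ) : 𝓞 K) = (k : 𝓞 K) * (f : 𝓞 K) := by push_cast; ring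
      rw [this]
      exact Ideal.mul_mem_left _ _ (Ideal.mul_mem_left _ _ (Ideal.mem_span_singleton_self _))
  · have hcop : v.asIdeal ⊔ Ideal.span {(f : 𝓞 K)} = ⊤ := by
      rw [hvℓ]; exact span_natCast_sup_eq_top f hℓ
    exact (hspl v ((sup_span_eq_top_iff_not_le f).mp hcop)).mpr
      (primeClass_eq_one_of_span_natCast f hvℓ hℓ)

end ClassField

end RingClassField

end Literature.NumberTheory.NumberFields
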